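import Summits.QuantumFields.BalabanUV.Beta.DiagonalContact

/-!
# `BalabanUV.Beta.GAN24.LinKerBlockTotals` — binder row G-an2-4 ∕ (CONV-C), CT-W «WC-TL» → «QR-LL», the (S) row of RULING R-gan24p1-g27-1, the plain sub-row (T-F)
# of (W-γ): **THE BLOCK-SUMMED ROOTED FIRST-ORDER AVERAGING KERNEL** — «straight contours cover every bond `L` times, the axial tails telescope»:
# `Σ'_{y′} q¹,ρ_{(κ, y′)}(l, y) = 𝟙[κ = l]·L^{−d}` (road-P2 chair `b2b-balaban-gan24-p2`, gen 40, INTENT 1; ingredient (b) of the (T-F) assembly)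

NOT IN PRINT; OUR BOOKKEEPING ([folklore] lattice bookkeeping over node 5ρ's rooted contours `AveragingContoursRooted.linAvgAt ∕ LamAt`
(`linAvgAt_eq_contourSum_sub_dz`: the rooted averaging = an2's straight-contour sum MINUS the coarse exact form `dz Λ^ρ`), node 7a's letter support
`AveragingHessianKernels.lettersIn_axial`, an2's block regrouping `KKTFluctuationEnergy.tsum_blocks`, and an2-g?'s bridge
`BorderedHessian.linAvgAt_delta1_eq_pow_mul_linKerAt`, all BY NAME; 0 `def`, 0 cited fact, 0 `def … : Prop`, 0 sorry).  HONEST FRAMING (cell contract, verbatim):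
«discharging `BetaPertH` makes Bałaban's UV stability UNCONDITIONAL — a real constructive-QFT result; it is NOT the continuum limit and NOT the Clay problem.»
HONEST DEPENDENCY (verbatim): «continuum YM on T⁴ ⇐ BetaPertH ∧ nine spine estimates (0/9 proved); BetaPertH ⇐ (D1) ∧ (D4) ∧ CAP+tail; G-an2-4 gates asym, D1 and NE2/3/4.»

WHAT (`d + 1` dimensions, blocking `N ≥ 1`, in-block root `ρ = toSite r`, `r ∈ box (d+1) N`; `q¹,ρ_{(κ,y′)}(l, y) = linKerAt ρ N κ y′ (l, y)` = an1's rooted first-order averaging kernel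
= the signed number of passages of the rooted contours `Γ^ρ_{c,x}`, `x ∈ B(y′)`, `c = (κ, y′)`, through the fine bond `(l, y)`, over `N^{d+1}`).
* §1 `listSum_eq_zero_of_lettersIn_delta1` (a letter list drawn from the bond indicator `delta1 l y` over a region avoiding `y` sums to `0`),
  **`LamAt_delta1_eq_zero`**: the rooted block axial potential of a bond indicator, `Λ^ρ[δ_{(l,y)}](y′)`, vanishes unless `y′ = blk N y` — so it is
  finitely supported (`summable_LamAt_delta1`, `summable_dz_LamAt_delta1`), and **`tsum_dz_LamAt_delta1`**: its coarse gradient has ZERO lattice total (the axial tails telescope).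
* §2 **`tsum_contourSum_delta1`** (+ `summable_contourSum_delta1`): `Σ'_{y′} contourSum N (delta1 l y) κ y′ = 𝟙[κ = l]·N` — the straight contours `[x, x + N·e_κ]`, `x ∈ ℤ^{d+1}`, pass through the
  bond `(l, y)` exactly `N` times when `κ = l` and never otherwise (block regrouping + one point mass per offset `s < N`).
* §3 **`tsum_linAvgAt_delta1`** (`= 𝟙[κ = l]·N`), `summable_linAvgAt_delta1`, **`summable_linKerAt`**, **`tsum_linKerAt`**: `Σ'_{y′} linKerAt ρ N κ y′ (l, y) = 𝟙[κ = l]·(N^d)⁻¹`, and the bond-indexed form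
  **`tsum_linKerAt'`** (`f : Bond`).  CONSUMER: the (T-F) assembly (INTENT 3 `WardResidualFieldTotals`): after leaf-02 g47's border `dψ`-law
  `BorderGaugeLegContact.tsum_vhSAt_mul_dz` the (γ) total read weight carries `Σ'_w (ψ(u′+e_κ′) − 𝟙[w + e_μ = y])·q¹,ρ_{(μ,w)}(κ′,u′)`; the first
  term is THIS total, the second is an3's `E3CoDressedContact.sum_tsum_colH_mul_linKerAt_of_EMA_border`.
Asserts NO value of Bałaban's tables; discharges NOTHING of (S) ∕ (Q-R) ∕ (LT) ∕ (Q-L) ∕ (C) ∕ «T2Shape» ∕ «T2Drift» ∕ (hW, hWall); NEVER «G-an2-4 closed» as (CONV-C); NOT D1,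
NOT BetaPertH, NOT continuum, NOT Clay.  2026-08-22; no existing file touched.
-/

noncomputable section

open Finset
open scoped BigOperators
open Literature.MathematicalPhysics.QuantumFieldTheory
open Literature.MathematicalPhysics.QuantumFieldTheory.Balaban1983to89
open Literature.MathematicalPhysics.QuantumFieldTheory.Balaban1983to89.Beta
open AffineAveraging (box toSite unitVec dz contourSum)
open AveragingContours (blk axial)
open AveragingContoursRooted (linAvgAt LamAt linAvgAt_eq_contourSum_sub_dz)
open AveragingHessianKernels (Bond Hull LettersIn lettersIn_axial)
open AveragingHessianKernelsRooted (linKerAt)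
open KKTFluctuationKernel (delta1 delta1_apply)
open KKTFluctuationEnergy (tsum_blocks summable_blocks)
open Summit.QuantumFields.BalabanUV.Beta.BorderedHessian (linAvgAt_delta1_eq_pow_mul_linKerAt)

namespace Summit.QuantumFields.BalabanUV.Beta.GAN24.LinKerBlockTotals

variable {d : ℕ}

/-! ## §1 The rooted block axial potential of a bond indicator is supported on one block -/

/-- [folklore] A letter list drawn from the bond indicator `delta1 l y` over a region of base points avoiding `y` sums to zero. -/
theorem listSum_eq_zero_of_lettersIn_delta1 {P : (Fin (d + 1) → ℤ) → Prop} {l : Fin (d + 1)} {y : Fin (d + 1) → ℤ} (hy : ¬ P y)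
    {lst : List ℝ} (h : LettersIn (delta1 l y) P lst) : lst.sum = 0 := by
  refine List.sum_eq_zero fun a ha => ?_
  obtain ⟨κ, x, hx, ha'⟩ := h a ha
  have h0 : delta1 l y κ x = 0 := by
    rw [delta1_apply, if_neg]
    rintro ⟨-, rfl⟩
    exact hy hx
  rcases ha' with e | e
  · rw [e, h0]
  · rw [e, h0, neg_zero]

/-- NOT IN PRINT; OUR BOOKKEEPING.  **THE ROOTED BLOCK AXIAL POTENTIAL OF A BOND INDICATOR LIVES ON ONE BLOCK**: for an in-block root and `N ≥ 1`,
`LamAt ρ (delta1 l y) N y′ = 0` unless `y′ = blk N y` (every letter of `Γ_{r(y′), x}`, `x ∈ B(y′)`, is a bond based in the block `B(y′)` — node 7a's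
`lettersIn_axial` hull between two points of the block). -/
theorem LamAt_delta1_eq_zero {N : ℕ} (hN : 1 ≤ N) {r : Fin (d + 1) → ℕ} (hr : r ∈ box (d + 1) N) (l : Fin (d + 1)) (y : Fin (d + 1) → ℤ)
    {y' : Fin (d + 1) → ℤ} (hy' : y' ≠ blk N y) : LamAt (toSite r) (delta1 l y) N y' = 0 := by
  have hr' : ∀ i, r i < N := by simpa [AffineAveraging.box, Fintype.mem_piFinset, Finset.mem_range] using hr
  unfold LamAt
  refine Finset.sum_eq_zero fun b hb => ?_
  have hb' : ∀ i, b i < N := by simpa [AffineAveraging.box, Fintype.mem_piFinset, Finset.mem_range] using hb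
  refine listSum_eq_zero_of_lettersIn_delta1 (P := Hull ((N : ℤ) • y' + toSite r) ((N : ℤ) • y' + toSite b)) ?_ (lettersIn_axial _ _ _)
  intro hH
  apply hy'
  funext i
  obtain ⟨h1, h2⟩ := hH i
  simp only [Pi.add_apply, Pi.smul_apply, smul_eq_mul, toSite] at h1 h2
  rw [min_le_iff] at h1
  rw [le_max_iff] at h2
  have hri := hr' i
  have hbi := hb' i
  have hN0 : (0 : ℤ) < N := by exact_mod_cast hN
  have lo : (N : ℤ) * y' i ≤ y i := by rcases h1 with h1 | h1 <;> linarith [Int.natCast_nonneg (r i), Int.natCast_nonneg (b i)]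
  have hi : y i < (N : ℤ) * (y' i + 1) := by
    have hr2 : ((r i : ℕ) : ℤ) < N := by exact_mod_cast hri
    have hb2 : ((b i : ℕ) : ℤ) < N := by exact_mod_cast hbi
    rcases h2 with h2 | h2 <;> linarith
  show y' i = y i / (N : ℤ)
  refine le_antisymm ?_ ?_
  · rw [Int.le_ediv_iff_mul_le hN0]; linarith
  · have : y i / (N : ℤ) < y' i + 1 := by rw [Int.ediv_lt_iff_lt_mul hN0]; linarith
    omega

/-- [folklore] Hence `y′ ↦ LamAt ρ (delta1 l y) N y′` is summable (finitely supported). -/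
theorem summable_LamAt_delta1 {N : ℕ} (hN : 1 ≤ N) {r : Fin (d + 1) → ℕ} (hr : r ∈ box (d + 1) N) (l : Fin (d + 1)) (y : Fin (d + 1) → ℤ) :
    Summable fun y' : Fin (d + 1) → ℤ => LamAt (toSite r) (delta1 l y) N y' := by
  refine summable_of_ne_finset_zero (s := {blk N y}) fun y' hy' => ?_
  rw [Finset.mem_singleton] at hy'
  exact LamAt_delta1_eq_zero hN hr l y hy'

/-- [folklore] … and so is its shift `y′ ↦ Λ(y′ + e_κ)`, hence the coarse gradient `y′ ↦ dz Λ κ y′`. -/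
theorem summable_dz_LamAt_delta1 {N : ℕ} (hN : 1 ≤ N) {r : Fin (d + 1) → ℕ} (hr : r ∈ box (d + 1) N) (l : Fin (d + 1)) (y : Fin (d + 1) → ℤ)
    (κ : Fin (d + 1)) : Summable fun y' : Fin (d + 1) → ℤ => dz (LamAt (toSite r) (delta1 l y) N) κ y' := by
  set Λ : (Fin (d + 1) → ℤ) → ℝ := fun y' => LamAt (toSite r) (delta1 l y) N y' with hΛ
  have hs : Summable Λ := summable_LamAt_delta1 hN hr l y
  have hs' : Summable (Λ ∘ ⇑(Equiv.addRight (unitVec κ))) := (Equiv.addRight (unitVec κ)).summable_iff.mpr hs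
  have edz : (fun y' : Fin (d + 1) → ℤ => dz (LamAt (toSite r) (delta1 l y) N) κ y') = fun y' => (Λ ∘ ⇑(Equiv.addRight (unitVec κ))) y' - Λ y' :=
    funext fun y' => rfl
  rw [edz]
  exact hs'.sub hs

/-- NOT IN PRINT; OUR BOOKKEEPING.  **THE AXIAL TAILS TELESCOPE**: the coarse gradient of the rooted block axial potential of a bond indicator has zero lattice
total, `Σ'_{y′} dz (LamAt ρ (delta1 l y) N) κ y′ = 0` (translation invariance of the lattice sum of a finitely supported function). -/
theorem tsum_dz_LamAt_delta1 {N : ℕ} (hN : 1 ≤ N) {r : Fin (d + 1) → ℕ} (hr : r ∈ box (d + 1) N) (l : Fin (d + 1)) (y : Fin (d + 1) → ℤ)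
    (κ : Fin (d + 1)) : ∑' y' : Fin (d + 1) → ℤ, dz (LamAt (toSite r) (delta1 l y) N) κ y' = 0 := by
  set Λ : (Fin (d + 1) → ℤ) → ℝ := fun y' => LamAt (toSite r) (delta1 l y) N y' with hΛ
  have hs : Summable Λ := summable_LamAt_delta1 hN hr l y
  have hs' : Summable (Λ ∘ ⇑(Equiv.addRight (unitVec κ))) := (Equiv.addRight (unitVec κ)).summable_iff.mpr hs
  have e : ∑' y' : Fin (d + 1) → ℤ, (Λ ∘ ⇑(Equiv.addRight (unitVec κ))) y' = ∑' y' : Fin (d + 1) → ℤ, Λ y' :=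
    (Equiv.addRight (unitVec κ)).tsum_eq Λ
  have edz : ∀ y' : Fin (d + 1) → ℤ, dz (LamAt (toSite r) (delta1 l y) N) κ y' = (Λ ∘ ⇑(Equiv.addRight (unitVec κ))) y' - Λ y' := fun y' => rfl
  rw [tsum_congr edz, hs'.tsum_sub hs, e, sub_self]

/-! ## §2 The straight contours pass through a bond `N` times -/

/-- NOT IN PRINT; OUR BOOKKEEPING.  **THE STRAIGHT CONTOURS COVER EVERY BOND `N` TIMES**: `Σ'_{y′} contourSum N (delta1 l y) κ y′ = 𝟙[κ = l]·N` — regroup the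
block sum into a lattice sum (an2's `tsum_blocks`) for each offset `s < N` along the contour; each is the point mass at `y − s·e_κ`. -/
theorem tsum_contourSum_delta1 {N : ℕ} [NeZero N] (l : Fin (d + 1)) (y : Fin (d + 1) → ℤ) (κ : Fin (d + 1)) :
    ∑' y' : Fin (d + 1) → ℤ, contourSum N (delta1 l y) κ y' = if κ = l then (N : ℝ) else 0 := by
  classical
  -- the offset-`s` point mass
  set g : ℕ → (Fin (d + 1) → ℤ) → ℝ := fun s x => delta1 l y κ (x + (s : ℤ) • unitVec κ) with hg
  have hg0 : ∀ (s : ℕ) (x : Fin (d + 1) → ℤ), x ≠ y - (s : ℤ) • unitVec κ → g s x = 0 := fun s x hx => by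
    simp only [hg, delta1_apply]
    rw [if_neg]
    rintro ⟨-, h⟩
    exact hx (by rw [← h, add_sub_cancel_right])
  have hgs : ∀ s : ℕ, Summable (g s) := fun s =>
    summable_of_ne_finset_zero (s := {y - (s : ℤ) • unitVec κ}) fun x hx => hg0 s x (by rwa [Finset.mem_singleton] at hx)
  have hgt : ∀ s : ℕ, ∑' x, g s x = if κ = l then (1 : ℝ) else 0 := fun s => by
    rw [tsum_eq_single (y - (s : ℤ) • unitVec κ) (fun x hx => hg0 s x hx)]
    simp only [hg, delta1_apply, sub_add_cancel, and_true]
  -- contour sum = sum over offsets of block sums of `g s`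
  have e1 : ∀ y' : Fin (d + 1) → ℤ, contourSum N (delta1 l y) κ y' = ∑ s ∈ Finset.range N, ∑ b ∈ box (d + 1) N, g s ((N : ℤ) • y' + toSite b) := fun y' => by
    simp only [contourSum, hg]
    rw [Finset.sum_comm]
  rw [tsum_congr e1, Summable.tsum_finsetSum (fun s _ => summable_blocks (N := N) (hgs s))]
  have e2 : ∀ s ∈ Finset.range N, ∑' y' : Fin (d + 1) → ℤ, ∑ b ∈ box (d + 1) N, g s ((N : ℤ) • y' + toSite b) = if κ = l then (1 : ℝ) else 0 :=
    fun s _ => by rw [← tsum_blocks (N := N) (hgs s), hgt s]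
  rw [Finset.sum_congr rfl e2, Finset.sum_const, Finset.card_range, nsmul_eq_mul]
  split_ifs <;> simp

/-- [folklore] The straight-contour sums of a bond indicator form a summable (finitely supported) coarse family. -/
theorem summable_contourSum_delta1 {N : ℕ} [NeZero N] (l : Fin (d + 1)) (y : Fin (d + 1) → ℤ) (κ : Fin (d + 1)) :
    Summable fun y' : Fin (d + 1) → ℤ => contourSum N (delta1 l y) κ y' := by
  classical
  set g : ℕ → (Fin (d + 1) → ℤ) → ℝ := fun s x => delta1 l y κ (x + (s : ℤ) • unitVec κ) with hg
  have hgs : ∀ s : ℕ, Summable (g s) := fun s =>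
    summable_of_ne_finset_zero (s := {y - (s : ℤ) • unitVec κ}) fun x hx => by
      rw [Finset.mem_singleton] at hx
      simp only [hg, delta1_apply]
      rw [if_neg]
      rintro ⟨-, h⟩
      exact hx (by rw [← h, add_sub_cancel_right])
  have e1 : (fun y' : Fin (d + 1) → ℤ => contourSum N (delta1 l y) κ y')
      = fun y' => ∑ s ∈ Finset.range N, ∑ b ∈ box (d + 1) N, g s ((N : ℤ) • y' + toSite b) := by
    funext y'
    simp only [contourSum, hg]
    rw [Finset.sum_comm]
  rw [e1]
  exact summable_sum fun s _ => summable_blocks (N := N) (hgs s)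

/-! ## §3 The block-summed rooted kernel -/

/-- NOT IN PRINT; OUR BOOKKEEPING.  **THE BLOCK-SUMMED ROOTED LINEARISED AVERAGING OF A BOND INDICATOR**: `Σ'_{y′} linAvgAt ρ (delta1 l y) N κ y′ = 𝟙[κ = l]·N`
(§2 minus §1's zero total, through node 5ρ's `linAvgAt_eq_contourSum_sub_dz`). -/
theorem tsum_linAvgAt_delta1 {N : ℕ} [NeZero N] (hN : 1 ≤ N) {r : Fin (d + 1) → ℕ} (hr : r ∈ box (d + 1) N) (l : Fin (d + 1)) (y : Fin (d + 1) → ℤ)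
    (κ : Fin (d + 1)) : ∑' y' : Fin (d + 1) → ℤ, linAvgAt (toSite r) (delta1 l y) N κ y' = if κ = l then (N : ℝ) else 0 := by
  have e : ∀ y' : Fin (d + 1) → ℤ, linAvgAt (toSite r) (delta1 l y) N κ y'
      = contourSum N (delta1 l y) κ y' - dz (LamAt (toSite r) (delta1 l y) N) κ y' := fun y' => linAvgAt_eq_contourSum_sub_dz _ _ _ _ _
  have hdz := summable_dz_LamAt_delta1 hN hr l y κ
  rw [tsum_congr e, (summable_contourSum_delta1 l y κ).tsum_sub hdz, tsum_contourSum_delta1, tsum_dz_LamAt_delta1 hN hr, sub_zero]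

/-- [folklore] The rooted linearised averagings of a bond indicator form a summable coarse family (straight part + exact part). -/
theorem summable_linAvgAt_delta1 {N : ℕ} [NeZero N] (hN : 1 ≤ N) {r : Fin (d + 1) → ℕ} (hr : r ∈ box (d + 1) N) (l : Fin (d + 1))
    (y : Fin (d + 1) → ℤ) (κ : Fin (d + 1)) : Summable fun y' : Fin (d + 1) → ℤ => linAvgAt (toSite r) (delta1 l y) N κ y' := by
  have e : (fun y' : Fin (d + 1) → ℤ => linAvgAt (toSite r) (delta1 l y) N κ y')
      = fun y' => contourSum N (delta1 l y) κ y' - dz (LamAt (toSite r) (delta1 l y) N) κ y' :=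
    funext fun y' => linAvgAt_eq_contourSum_sub_dz _ _ _ _ _
  rw [e]
  exact (summable_contourSum_delta1 l y κ).sub (summable_dz_LamAt_delta1 hN hr l y κ)

/-- [folklore] **`y′ ↦ linKerAt ρ N κ y′ f` IS SUMMABLE** (in-block root): the rooted kernel read over all coarse bonds of one direction, bond `f` fixed. -/
theorem summable_linKerAt {N : ℕ} [NeZero N] (hN : 1 ≤ N) {r : Fin (d + 1) → ℕ} (hr : r ∈ box (d + 1) N) (κ : Fin (d + 1)) (f : Bond (d + 1)) :
    Summable fun y' : Fin (d + 1) → ℤ => linKerAt (toSite r) N κ y' f := by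
  obtain ⟨l, y⟩ := f
  have hNp : (N : ℝ) ^ (d + 1) ≠ 0 := pow_ne_zero _ (by exact_mod_cast NeZero.ne N)
  have e : (fun y' : Fin (d + 1) → ℤ => linKerAt (toSite r) N κ y' (l, y))
      = fun y' => ((N : ℝ) ^ (d + 1))⁻¹ * linAvgAt (toSite r) (delta1 l y) N κ y' :=
    funext fun y' => by rw [linAvgAt_delta1_eq_pow_mul_linKerAt, inv_mul_cancel_left₀ hNp]
  rw [e]
  exact (summable_linAvgAt_delta1 hN hr l y κ).mul_left _

/-- NOT IN PRINT; OUR BOOKKEEPING.  **THE BLOCK-SUMMED ROOTED FIRST-ORDER AVERAGING KERNEL**: for an in-block root and `N ≥ 1`,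
`Σ'_{y′} linKerAt ρ N κ y′ (l, y) = 𝟙[κ = l]·(N^d)⁻¹` — summed over all coarse bonds of direction `κ`, the rooted kernel sees the fine bond `(l, y)` exactly
`N` times (the straight segments; the axial tails from the roots cancel between neighbouring blocks), over the normalisation `N^{d+1}`. -/
theorem tsum_linKerAt {N : ℕ} [NeZero N] (hN : 1 ≤ N) {r : Fin (d + 1) → ℕ} (hr : r ∈ box (d + 1) N) (l : Fin (d + 1)) (y : Fin (d + 1) → ℤ)
    (κ : Fin (d + 1)) : ∑' y' : Fin (d + 1) → ℤ, linKerAt (toSite r) N κ y' (l, y) = if κ = l then ((N : ℝ) ^ d)⁻¹ else 0 := by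
  have hN0 : (N : ℝ) ≠ 0 := by exact_mod_cast NeZero.ne N
  have hNp : (N : ℝ) ^ (d + 1) ≠ 0 := pow_ne_zero _ hN0
  have e : ∀ y' : Fin (d + 1) → ℤ, linKerAt (toSite r) N κ y' (l, y) = ((N : ℝ) ^ (d + 1))⁻¹ * linAvgAt (toSite r) (delta1 l y) N κ y' := fun y' => by
    rw [linAvgAt_delta1_eq_pow_mul_linKerAt, inv_mul_cancel_left₀ hNp]
  rw [tsum_congr e, tsum_mul_left, tsum_linAvgAt_delta1 hN hr]
  split_ifs
  · rw [pow_succ, mul_inv, mul_assoc, inv_mul_cancel₀ hN0, mul_one]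
  · rw [mul_zero]

/-- NOT IN PRINT; OUR BOOKKEEPING.  The bond-indexed form: `Σ'_{y′} linKerAt ρ N κ y′ f = 𝟙[f.1 = κ]·(N^d)⁻¹`. -/
theorem tsum_linKerAt' {N : ℕ} [NeZero N] (hN : 1 ≤ N) {r : Fin (d + 1) → ℕ} (hr : r ∈ box (d + 1) N) (κ : Fin (d + 1)) (f : Bond (d + 1)) :
    ∑' y' : Fin (d + 1) → ℤ, linKerAt (toSite r) N κ y' f = if f.1 = κ then ((N : ℝ) ^ d)⁻¹ else 0 := by
  obtain ⟨l, y⟩ := f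
  rw [tsum_linKerAt hN hr l y κ]
  simp only [eq_comm]

end Summit.QuantumFields.BalabanUV.Beta.GAN24.LinKerBlockTotals

end
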